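import Literature.MathematicalPhysics.QuantumFieldTheory.BalabanImbrieJaffe1984to88.BIJ88HolderDecay213
import Literature.MathematicalPhysics.QuantumFieldTheory.BalabanImbrieJaffe1984to88.BIJ88MultiscaleDecay223Torus

/-!
# `BalabanImbrieJaffe1984to88.BIJ88HolderDecay213Torus` — T. Bałaban, J. Imbrie, A. Jaffe, *Effective action and cluster properties of the
abelian Higgs model*, Commun. Math. Phys. **114** (1988) 257–315 [BalabanImbrieJaffe1988]: p. 261, (2.13) second clause *"and similarly
for derivatives of 𝒟_{k,loc} and Hölder derivatives of order less than 2"* — the hence-step `BIJ88HolderDecay213` ON THE TORI OF RECORD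
`Balaban1983to89.Site P j` / `PBond P j` (distances `Site.tdist`, row sums by p20's `B3TorusRadialSums`), and the NON-VACUITY of its
per-scale hypotheses: the exponential majorants `AΛⁿe^{−δLⁿdist}` of the function clause themselves obey the Lipschitz hypothesis with
exactly one inverse length `Lⁿ` per scale

statement-level skeleton of published theorems with citation tags; proofs where landed; nothing here is a claim about the Yang–Mills mass gap

PDF held: `paper:balaban1988-cmp114-bij-abelian-higgs-effective-action` (journal page = PDF page + 256); p. 261 [PDF 5].

WHAT IS REPRODUCED.  SKELETON row **C2.Eq2.13** (owner r18; the «(+ derivatives, Hölder < 2)» clause), MODEL INSTANCE on the cell's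
carriers of record of the abstract hence-step `BIJ88HolderDecay213.holderOpDecay213` (seat p08 gen 5, p251843) — cell `lit-balaban`, HOME
`run/shared/lean/pub/lit-balaban/`; Phase-2 seat p08 gen 5 = unit `lit-balaban-p08` (third file of the generation); referee ref-5.
p. 261, verbatim: *"This propagator derives its regularity and decay from that of C^{(j)}_{loc} and H_{k,loc}. Thus |(𝒟_{k,loc}f)(b)| ≦
ce^{−c dist(suppt f,b)}‖f‖_∞, (2.13) and similarly for derivatives of 𝒟_{k,loc} and Hölder derivatives of order less than 2."*; same page,
with (2.16): *"[The rapid decay of the terms with small j compensates for the scaling factors (L^jη)^{−1}.]"*.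

WHAT IS PROVED (0 `sorry`, standard axioms; theorems only).
* §1 `abs_exp_neg_sub_le` — `|e^{−cu} − e^{−cv}| ≤ c|u − v|e^{−c·min{u,v}}` (`c ≥ 0`): an exponential profile of inverse length `c` is
  Lipschitz with constant `c` times its own value at the nearer point;
* §2 **`expMajorant_lipschitz`** / `expMajorant_sup` — THE READING EXEMPLIFIED: on any carriers where the input-to-output distance is
  1-Lipschitz in the output (`|dist(a,b) − dist(a,b′)| ≤ sep(b,b′)`), the per-scale majorants `E_n(b,a) = AΛⁿe^{−δLⁿdist(a,b)}` of the function
  clause satisfy the sup hypothesis of `BIJ88HolderDecay213.holderKernel_le` with constant `A·max{1,δ}` and its Lipschitz hypothesis with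
  the SAME constant and growth factor `M = L` — one inverse length `(L^jη)^{−1} = Lⁿ` per scale, exactly print's «scaling factors»; hence
  **`holderKernel_expMajorant`**: the Hölder-θ conclusion for the majorant family under the sole numerical condition `ΛL^θ < 1`;
* §3 on `Site P j` (input and output sites; `dist = sep = tdist`): `abs_tdist_sub_tdist_le` (reverse triangle inequality),
  **`holderOpDecay213_torus`** (a general hierarchical family with the per-scale sup/Lipschitz bounds in `tdist`: the operator Hölder bound of
  `holderOpDecay213` with the row sum `S = (2(1+(δ/2)⁻¹))^d` SUPPLIED, uniform in the volume — hypotheses reduced to the per-scale kernel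
  estimates and the numerics `L ≥ 1`, `ΛM^θ < 1`, `δ > 0`), **`holderOpDecay213_torus_expMajorant`** (every hypothesis discharged for the
  majorant family: a closed-form, non-vacuous instance), and the bond-output variant `holderOpDecay213_torus_bond` (the printed `(𝒟_{k,loc}f)(b)`,
  b a bond located at its source as in `Setup.KernelExpDecay`).
HONEST SCOPE.  As in `BIJ88HolderDecay213`: hence-steps from displayed per-scale bounds; the majorant family is a consistency witness for
the hypotheses (the true terms of (2.12) are controlled BY such majorants, [I] (7.2.2)–(7.2.3)-shape inputs not re-derived here); distances in
lattice steps of the scale-j carrier.  Nothing on d = 4 or the continuum; NOT summit progress.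
-/

namespace Literature.MathematicalPhysics.QuantumFieldTheory.BalabanImbrieJaffe1984to88.BIJ88HolderDecay213Torus

open Finset BIJ88Sect2Statements BIJ88OpDecay230Proof BIJ88MultiscaleDecay223 BIJ88HolderDecay213 BIJ88MultiscaleDecay223Torus
open Literature.MathematicalPhysics.QuantumFieldTheory.Balaban1983to89
open Literature.MathematicalPhysics.QuantumFieldTheory.Balaban1983to89.B3TorusRadialSums

noncomputable section

variable {α β : Type*}

/-! ## §1  An exponential profile is Lipschitz with one inverse length -/

/-- `|e^{−cu} − e^{−cv}| ≤ c·|u − v|·e^{−c·min{u,v}}` for `c ≥ 0`: the difference of an exponential profile of inverse length `c` at two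
points costs one factor `c` (times the separation) relative to its value at the nearer point. [cite: BalabanImbrieJaffe1988, (2.13) p.261] -/
theorem abs_exp_neg_sub_le {c u v : ℝ} (hc : 0 ≤ c) :
    |Real.exp (-c * u) - Real.exp (-c * v)| ≤ c * |u - v| * Real.exp (-c * min u v) := by
  -- the ordered case
  have key : ∀ u v : ℝ, u ≤ v →
      |Real.exp (-c * u) - Real.exp (-c * v)| ≤ c * |u - v| * Real.exp (-c * min u v) := by
    intro u v huv
    have hmin : min u v = u := min_eq_left huv
    have hle : Real.exp (-c * v) ≤ Real.exp (-c * u) := Real.exp_le_exp.2 (by nlinarith)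
    have hfac : Real.exp (-c * u) - Real.exp (-c * v) = Real.exp (-c * u) * (1 - Real.exp (-(c * (v - u)))) := by
      rw [mul_sub, mul_one, ← Real.exp_add]; ring_nf
    -- 1 − e^{−x} ≤ x
    have h1 : 1 - Real.exp (-(c * (v - u))) ≤ c * (v - u) := by
      have := Real.add_one_le_exp (-(c * (v - u)))
      linarith
    rw [abs_of_nonneg (sub_nonneg.2 hle), hmin, hfac, abs_of_nonpos (sub_nonpos.2 huv)]
    calc Real.exp (-c * u) * (1 - Real.exp (-(c * (v - u)))) ≤ Real.exp (-c * u) * (c * (v - u)) :=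
          mul_le_mul_of_nonneg_left h1 (Real.exp_pos _).le
      _ = c * -(u - v) * Real.exp (-c * u) := by ring
  rcases le_total u v with huv | hvu
  · exact key u v huv
  · have h := key v u hvu
    rwa [abs_sub_comm (Real.exp (-c * v)), abs_sub_comm v u, min_comm] at h

/-! ## §2  The per-scale majorants satisfy the hypotheses with `M = L` («the scaling factors (L^jη)^{−1}») -/

/-- **The sup hypothesis for the majorant family**, constant enlarged to `A·max{1,δ}` (so that one constant serves both hypotheses).
[cite: BalabanImbrieJaffe1988, (2.13) p.261] -/
theorem expMajorant_sup {dist : α → β → ℝ} {A Λ L δ : ℝ} (hA : 0 ≤ A) (hΛ : 0 ≤ Λ) (n : ℕ) (b : β) (a : α) :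
    |A * Λ ^ n * Real.exp (-(δ * L ^ n) * dist a b)|
      ≤ A * max 1 δ * Λ ^ n * Real.exp (-(δ * L ^ n) * dist a b) := by
  have hAΛ : 0 ≤ A * Λ ^ n := mul_nonneg hA (pow_nonneg hΛ n)
  rw [abs_of_nonneg (mul_nonneg hAΛ (Real.exp_pos _).le)]
  have h1 : A ≤ A * max 1 δ := le_mul_of_one_le_right hA (le_max_left _ _)
  have : A * Λ ^ n ≤ A * max 1 δ * Λ ^ n := mul_le_mul_of_nonneg_right h1 (pow_nonneg hΛ n)
  exact mul_le_mul_of_nonneg_right this (Real.exp_pos _).le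

/-- **The Lipschitz hypothesis for the majorant family, with exactly one inverse length `Lⁿ` per scale.**  If the input-to-output distance
is 1-Lipschitz in the output point (`|dist(a,b) − dist(a,b′)| ≤ sep(b,b′)`), then `E_n(b,a) = AΛⁿe^{−δLⁿdist(a,b)}` satisfies
`|E_n(b,a) − E_n(b′,a)| ≤ (A·max{1,δ})·Λⁿ·Lⁿ·sep(b,b′)·e^{−δLⁿmin{dist(a,b),dist(a,b′)}}` (`A, Λ, δ ≥ 0`, `L ≥ 0`) — print's *"scaling factors
(L^jη)^{−1}"*, one per derivative. [cite: BalabanImbrieJaffe1988, (2.13) p.261] -/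
theorem expMajorant_lipschitz {dist : α → β → ℝ} {sep : β → β → ℝ} {A Λ L δ : ℝ} (hA : 0 ≤ A) (hΛ : 0 ≤ Λ) (hL : 0 ≤ L)
    (hδ : 0 ≤ δ) (hdist : ∀ a b b', |dist a b - dist a b'| ≤ sep b b') (n : ℕ) (b b' : β) (a : α) :
    |A * Λ ^ n * Real.exp (-(δ * L ^ n) * dist a b) - A * Λ ^ n * Real.exp (-(δ * L ^ n) * dist a b')|
      ≤ A * max 1 δ * Λ ^ n * L ^ n * sep b b' * Real.exp (-(δ * L ^ n) * min (dist a b) (dist a b')) := by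
  have hAΛ : 0 ≤ A * Λ ^ n := mul_nonneg hA (pow_nonneg hΛ n)
  have hc : 0 ≤ δ * L ^ n := mul_nonneg hδ (pow_nonneg hL n)
  have hsep0 : 0 ≤ sep b b' := (abs_nonneg _).trans (hdist a b b')
  have h := abs_exp_neg_sub_le (u := dist a b) (v := dist a b') hc
  rw [← mul_sub, abs_mul, abs_of_nonneg hAΛ]
  calc A * Λ ^ n * |Real.exp (-(δ * L ^ n) * dist a b) - Real.exp (-(δ * L ^ n) * dist a b')|
      ≤ A * Λ ^ n * (δ * L ^ n * |dist a b - dist a b'| * Real.exp (-(δ * L ^ n) * min (dist a b) (dist a b'))) :=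
        mul_le_mul_of_nonneg_left h hAΛ
    _ ≤ A * Λ ^ n * (δ * L ^ n * sep b b' * Real.exp (-(δ * L ^ n) * min (dist a b) (dist a b'))) := by
        gcongr
        exact hdist a b b'
    _ = A * δ * Λ ^ n * L ^ n * sep b b' * Real.exp (-(δ * L ^ n) * min (dist a b) (dist a b')) := by ring
    _ ≤ A * max 1 δ * Λ ^ n * L ^ n * sep b b' * Real.exp (-(δ * L ^ n) * min (dist a b) (dist a b')) := by
        have h1 : A * δ ≤ A * max 1 δ := mul_le_mul_of_nonneg_left (le_max_right _ _) hA
        have hrest : 0 ≤ Λ ^ n * L ^ n * sep b b' * Real.exp (-(δ * L ^ n) * min (dist a b) (dist a b')) := by positivity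
        calc A * δ * Λ ^ n * L ^ n * sep b b' * Real.exp (-(δ * L ^ n) * min (dist a b) (dist a b'))
            = A * δ * (Λ ^ n * L ^ n * sep b b' * Real.exp (-(δ * L ^ n) * min (dist a b) (dist a b'))) := by ring
          _ ≤ A * max 1 δ * (Λ ^ n * L ^ n * sep b b' * Real.exp (-(δ * L ^ n) * min (dist a b) (dist a b'))) :=
              mul_le_mul_of_nonneg_right h1 hrest
          _ = _ := by ring

/-- **Non-vacuity of the hence-step, and the reading in closed form.**  For the majorant family `E_n(b,a) = AΛⁿe^{−δLⁿdist(a,b)}` on carriers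
with `dist, sep ≥ 0` and `|dist(a,b) − dist(a,b′)| ≤ sep(b,b′)`: for every `0 ≤ θ ≤ 1` with **`ΛL^θ < 1`** (`L ≥ 1`, `A, Λ, δ ≥ 0`), every `N`,
`b`, `b′`, `a`: `|Σ_{n<N}(E_n(b,a) − E_n(b′,a))| ≤ (2^{1−θ}A·max{1,δ}/(1 − ΛL^θ))·sep(b,b′)^θ·e^{−δ min{dist(a,b),dist(a,b′)}}` — by
`BIJ88HolderDecay213.holderKernel_le` with `M = L`. [cite: BalabanImbrieJaffe1988, (2.13) p.261] -/
theorem holderKernel_expMajorant {dist : α → β → ℝ} {sep : β → β → ℝ} {A Λ L δ θ : ℝ} (hL : 1 ≤ L) (hΛ : 0 ≤ Λ)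
    (hA : 0 ≤ A) (hδ : 0 ≤ δ) (hθ0 : 0 ≤ θ) (hθ1 : θ ≤ 1) (hr : Λ * L ^ θ < 1) (hd : ∀ a b, 0 ≤ dist a b)
    (hsep : ∀ b b', 0 ≤ sep b b') (hdist : ∀ a b b', |dist a b - dist a b'| ≤ sep b b') (N : ℕ) (b b' : β) (a : α) :
    |∑ n ∈ range N, (A * Λ ^ n * Real.exp (-(δ * L ^ n) * dist a b) - A * Λ ^ n * Real.exp (-(δ * L ^ n) * dist a b'))|
      ≤ 2 ^ (1 - θ) * (A * max 1 δ) / (1 - Λ * L ^ θ) * sep b b' ^ θ * Real.exp (-δ * min (dist a b) (dist a b')) :=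
  holderKernel_le (D := fun n b a => A * Λ ^ n * Real.exp (-(δ * L ^ n) * dist a b)) hL hΛ (zero_le_one.trans hL)
    (mul_nonneg hA (zero_le_one.trans (le_max_left _ _))) hδ hθ0 hθ1 hr hd hsep (fun n b a => expMajorant_sup hA hΛ n b a)
    (fun n b b' a => expMajorant_lipschitz hA hΛ (zero_le_one.trans hL) hδ hdist n b b' a) N b b' a

/-! ## §3  On the tori of record `Site P j` / `PBond P j` -/

variable {P : Params} {j : ℕ}

/-- kernel: the `ℓ¹` torus distance is symmetric. [folklore] -/
private theorem tdist_comm' (x y : Site P j) : Site.tdist x y = Site.tdist y x := by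
  simp only [Site.tdist, min_comm]

/-- kernel: subadditivity of the circular size `min(val a, val(−a))` on `ℤ/N` (the private lemma of `BIJ85Ineq724Proof` §4, copied).
[folklore] -/
private theorem circ_add_le' {N : ℕ} [NeZero N] (a b : ZMod N) :
    min (a + b).val (-(a + b)).val ≤ min a.val (-a).val + min b.val (-b).val := by
  rcases le_total a.val (-a).val with ha | ha <;> rcases le_total b.val (-b).val with hb | hb
  · rw [min_eq_left ha, min_eq_left hb]
    exact (min_le_left _ _).trans (ZMod.val_add_le a b)
  · rw [min_eq_left ha, min_eq_right hb]
    rcases le_total (-b).val a.val with h | h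
    · have e : a + b = a - -b := by ring
      calc min (a + b).val (-(a + b)).val ≤ (a + b).val := min_le_left _ _
        _ = a.val - (-b).val := by rw [e, ZMod.val_sub h]
        _ ≤ a.val + (-b).val := by omega
    · have e : -(a + b) = -b - a := by ring
      calc min (a + b).val (-(a + b)).val ≤ (-(a + b)).val := min_le_right _ _
        _ = (-b).val - a.val := by rw [e, ZMod.val_sub h]
        _ ≤ a.val + (-b).val := by omega
  · rw [min_eq_right ha, min_eq_left hb]
    rcases le_total (-a).val b.val with h | h
    · have e : a + b = b - -a := by ring
      calc min (a + b).val (-(a + b)).val ≤ (a + b).val := min_le_left _ _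
        _ = b.val - (-a).val := by rw [e, ZMod.val_sub h]
        _ ≤ (-a).val + b.val := by omega
    · have e : -(a + b) = -a - b := by ring
      calc min (a + b).val (-(a + b)).val ≤ (-(a + b)).val := min_le_right _ _
        _ = (-a).val - b.val := by rw [e, ZMod.val_sub h]
        _ ≤ (-a).val + b.val := by omega
  · rw [min_eq_right ha, min_eq_right hb]
    have e : -(a + b) = -a + -b := by ring
    calc min (a + b).val (-(a + b)).val ≤ (-(a + b)).val := min_le_right _ _
      _ ≤ (-a).val + (-b).val := by rw [e]; exact ZMod.val_add_le _ _

/-- kernel: triangle inequality for `Site.tdist` (lattice steps; copied private lemma). [folklore] -/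
private theorem tdist_triangle' (x y z : Site P j) : Site.tdist x z ≤ Site.tdist x y + Site.tdist y z := by
  unfold Site.tdist
  rw [← Finset.sum_add_distrib]
  refine Finset.sum_le_sum fun μ _ => ?_
  have e1 : x μ - z μ = (x μ - y μ) + (y μ - z μ) := by ring
  have e2 : z μ - x μ = -((x μ - y μ) + (y μ - z μ)) := by ring
  have e3 : y μ - x μ = -(x μ - y μ) := by ring
  have e4 : z μ - y μ = -(y μ - z μ) := by ring
  rw [e1, e2, e3, e4]
  exact circ_add_le' _ _

/-- **The torus distance from an input site is 1-Lipschitz in the output site**: `|tdist(a,b) − tdist(a,b′)| ≤ tdist(b,b′)` (reverse triangle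
inequality) — the hypothesis `hdist` of §2 on the carriers of record. [cite: BalabanImbrieJaffe1988, (2.13) p.261] -/
theorem abs_tdist_sub_tdist_le (a b b' : Site P j) :
    |((Site.tdist a b : ℕ) : ℝ) - (Site.tdist a b' : ℕ)| ≤ (Site.tdist b b' : ℕ) := by
  rw [abs_sub_le_iff]
  constructor
  · have h := tdist_triangle' a b' b
    rw [tdist_comm' b' b] at h
    have : ((Site.tdist a b : ℕ) : ℝ) ≤ (Site.tdist a b' : ℕ) + (Site.tdist b b' : ℕ) := by exact_mod_cast h
    linarith
  · have h := tdist_triangle' a b b'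
    have : ((Site.tdist a b' : ℕ) : ℝ) ≤ (Site.tdist a b : ℕ) + (Site.tdist b b' : ℕ) := by exact_mod_cast h
    linarith

/-- **(2.13), derivatives / Hölder clause, ON THE TORUS (sites to sites).**  A hierarchical family of site kernels `D_n` (output b, input a)
with per-scale sup bounds `|D_n(b,a)| ≤ AΛⁿe^{−δLⁿtdist(a,b)}` and per-scale Lipschitz bounds
`|D_n(b,a) − D_n(b′,a)| ≤ AΛⁿMⁿ·tdist(b,b′)·e^{−δLⁿmin{tdist(a,b),tdist(a,b′)}}`, `L ≥ 1`, `Λ, M, A ≥ 0`, `δ > 0`, `0 ≤ θ ≤ 1`, `ΛM^θ < 1`: for all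
`N`, `f`, `b`, `b′`, `|(Σ_nD_n f)(b) − (Σ_nD_n f)(b′)| ≤ (2^{1−θ}A/(1−ΛM^θ))·tdist(b,b′)^θ·2(2(1+(δ/2)⁻¹))^d·e^{−(δ/2)dist(suppt f,{b,b′})}‖f‖_∞`
— the row sum supplied by p20's `B3TorusRadialSums.sum_exp_neg_tdist_le`, uniform in the volume. [cite: BalabanImbrieJaffe1988, (2.13) p.261] -/
theorem holderOpDecay213_torus {D : ℕ → Site P j → Site P j → ℝ} {A Λ M L δ θ : ℝ} (hL : 1 ≤ L) (hΛ : 0 ≤ Λ) (hM : 0 ≤ M)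
    (hA : 0 ≤ A) (hδ : 0 < δ) (hθ0 : 0 ≤ θ) (hθ1 : θ ≤ 1) (hr : Λ * M ^ θ < 1)
    (hsup : ∀ n b a, |D n b a| ≤ A * Λ ^ n * Real.exp (-(δ * L ^ n) * (Site.tdist a b : ℝ)))
    (hlip : ∀ n b b' a, |D n b a - D n b' a| ≤ A * Λ ^ n * M ^ n * (Site.tdist b b' : ℝ)
      * Real.exp (-(δ * L ^ n) * min (Site.tdist a b : ℝ) (Site.tdist a b' : ℝ)))
    (N : ℕ) (f : Site P j → ℝ) (b b' : Site P j) :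
    |applyK (fun b a => ∑ n ∈ range N, D n b a) f b - applyK (fun b a => ∑ n ∈ range N, D n b a) f b'|
      ≤ 2 ^ (1 - θ) * A / (1 - Λ * M ^ θ) * (Site.tdist b b' : ℝ) ^ θ * (2 * (2 * (1 + (δ / 2)⁻¹)) ^ P.d)
        * Real.exp (-(δ / 2) * suppDist (fun a (p : Site P j × Site P j) => min (Site.tdist a p.1 : ℝ) (Site.tdist a p.2 : ℝ)) f (b, b'))
        * supNorm f :=
  holderOpDecay213 (dist := fun a b => (Site.tdist a b : ℝ)) (sep := fun b b' => (Site.tdist b b' : ℝ)) hL hΛ hM hA hδ.le hθ0 hθ1 hr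
    (fun _ _ => by positivity) (fun _ _ => by positivity) hsup hlip (fun b => sum_exp_neg_tdist_le' (half_pos hδ) b) N f b b'

/-- **Every hypothesis discharged: the majorant family on the torus.**  For `E_n(b,a) = AΛⁿe^{−δLⁿtdist(a,b)}` on `Site P j`, `L ≥ 1`,
`A, Λ ≥ 0`, `δ > 0`, `0 ≤ θ ≤ 1` and **`ΛL^θ < 1`**: the Hölder-θ quotient of `Σ_{n<N}E_n f` obeys the (2.13)-shape bound with the explicit constant
`(2^{1−θ}A·max{1,δ}/(1−ΛL^θ))·2(2(1+(δ/2)⁻¹))^d`, for all `N`, `f`, `b`, `b′` — a closed-form, non-vacuous instance of the clause, uniform in the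
number of scales and in the volume. [cite: BalabanImbrieJaffe1988, (2.13) p.261] -/
theorem holderOpDecay213_torus_expMajorant {A Λ L δ θ : ℝ} (hL : 1 ≤ L) (hΛ : 0 ≤ Λ) (hA : 0 ≤ A) (hδ : 0 < δ)
    (hθ0 : 0 ≤ θ) (hθ1 : θ ≤ 1) (hr : Λ * L ^ θ < 1) (N : ℕ) (f : Site P j → ℝ) (b b' : Site P j) :
    |applyK (fun b a => ∑ n ∈ range N, A * Λ ^ n * Real.exp (-(δ * L ^ n) * (Site.tdist a b : ℝ))) f b
        - applyK (fun b a => ∑ n ∈ range N, A * Λ ^ n * Real.exp (-(δ * L ^ n) * (Site.tdist a b : ℝ))) f b'|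
      ≤ 2 ^ (1 - θ) * (A * max 1 δ) / (1 - Λ * L ^ θ) * (Site.tdist b b' : ℝ) ^ θ * (2 * (2 * (1 + (δ / 2)⁻¹)) ^ P.d)
        * Real.exp (-(δ / 2) * suppDist (fun a (p : Site P j × Site P j) => min (Site.tdist a p.1 : ℝ) (Site.tdist a p.2 : ℝ)) f (b, b'))
        * supNorm f :=
  holderOpDecay213_torus (D := fun n b a => A * Λ ^ n * Real.exp (-(δ * L ^ n) * (Site.tdist a b : ℝ))) hL hΛ (zero_le_one.trans hL)
    (mul_nonneg hA (zero_le_one.trans (le_max_left _ _))) hδ hθ0 hθ1 hr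
    (fun n b a => expMajorant_sup (dist := fun a b => (Site.tdist a b : ℝ)) (L := L) (δ := δ) hA hΛ n b a)
    (fun n b b' a => expMajorant_lipschitz (dist := fun a b => (Site.tdist a b : ℝ)) (sep := fun b b' => (Site.tdist b b' : ℝ))
      hA hΛ (zero_le_one.trans hL) hδ.le (fun a b b' => abs_tdist_sub_tdist_le a b b') n b b' a) N f b b'

/-- **The bond-output variant** (the printed `(𝒟_{k,loc}f)(b)` with b a bond of `T₁^{(k)}` located at its source, `f` a site function): Hölder
quotients between two output bonds `b, b′` at separation `tdist(b₋,b′₋)`, same constants. [cite: BalabanImbrieJaffe1988, (2.13) p.261] -/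
theorem holderOpDecay213_torus_bond {D : ℕ → PBond P j → Site P j → ℝ} {A Λ M L δ θ : ℝ} (hL : 1 ≤ L) (hΛ : 0 ≤ Λ) (hM : 0 ≤ M)
    (hA : 0 ≤ A) (hδ : 0 < δ) (hθ0 : 0 ≤ θ) (hθ1 : θ ≤ 1) (hr : Λ * M ^ θ < 1)
    (hsup : ∀ n b a, |D n b a| ≤ A * Λ ^ n * Real.exp (-(δ * L ^ n) * (Site.tdist a b.src : ℝ)))
    (hlip : ∀ n b b' a, |D n b a - D n b' a| ≤ A * Λ ^ n * M ^ n * (Site.tdist b.src b'.src : ℝ)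
      * Real.exp (-(δ * L ^ n) * min (Site.tdist a b.src : ℝ) (Site.tdist a b'.src : ℝ)))
    (N : ℕ) (f : Site P j → ℝ) (b b' : PBond P j) :
    |applyK (fun b a => ∑ n ∈ range N, D n b a) f b - applyK (fun b a => ∑ n ∈ range N, D n b a) f b'|
      ≤ 2 ^ (1 - θ) * A / (1 - Λ * M ^ θ) * (Site.tdist b.src b'.src : ℝ) ^ θ * (2 * (2 * (1 + (δ / 2)⁻¹)) ^ P.d)
        * Real.exp (-(δ / 2) * suppDist (fun a (p : PBond P j × PBond P j) =>
            min (Site.tdist a p.1.src : ℝ) (Site.tdist a p.2.src : ℝ)) f (b, b'))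
        * supNorm f :=
  holderOpDecay213 (dist := fun a (b : PBond P j) => (Site.tdist a b.src : ℝ))
    (sep := fun b b' : PBond P j => (Site.tdist b.src b'.src : ℝ)) hL hΛ hM hA hδ.le hθ0 hθ1 hr (fun _ _ => by positivity)
    (fun _ _ => by positivity) hsup hlip (fun b => sum_exp_neg_tdist_le' (half_pos hδ) b.src) N f b b'

end

end Literature.MathematicalPhysics.QuantumFieldTheory.BalabanImbrieJaffe1984to88.BIJ88HolderDecay213Torus
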